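import Literature.MathematicalPhysics.QuantumFieldTheory.Balaban1983to89.TorusHypercubicSymmetry

/-!
# `Balaban1983to89.B12EuclTransf218` — [Balaban1987RG1] (2.17)–(2.18) p. 269: the action of a Euclidean symmetry
on the split configuration `V = V′V^{(k)}`, the identity `r(V′V^{(k)}) = (rV′)(rV^{(k)})`, and the orthogonality of
the induced transformation of the fluctuation field `B′`

HONEST FRAMING (cell `lit-balaban`, verbatim): statement-level skeleton of published theorems with citation tags; proofs where landed; nothing here is a claim about the Yang–Mills mass gap.

CITATION HEADER.  T. Bałaban, *Renormalization group approach to lattice gauge field theories. I. Generation of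
effective actions in a small field approximation and a coupling constant renormalization in four dimensions*,
Commun. Math. Phys. **109** (1987) 249–301, doi:10.1007/bf01215223 [Balaban1987RG1] (cell paper B12; held text
`paper:balaban1987-cmp109-rg-i-small-field`, journal page = PDF page + 248; the displays (2.16)–(2.18) were read from
the page render `b2b-balaban-ref1/pages/1987-cmp109-rg-I-small-field/…-p021-x2.png` (p. 269); the split
`V = V′V^{(k)}` from `…-p017-x2.png` (p. 265)).  Unit `lit-balaban-r09` gen 2 (Phase 2, PHASE2-TARGETS §G seat p10),
SKELETON row `B12.Eq2.17-2.18`.  Pre-existing carriers at the locus (2.17) (named, not re-declared): the symmetry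
maps `GaugeField.permute` / `GaugeField.reflect` (`TorusHypercubicSymmetry`, with the orientation rule
`PBond.reflect`), `GaugeField.translate` (`TorusLimitAxioms`), the invariance shape
`B12SmallFieldDomain259.EuclInvariant`, the block-compatible centred reflections `T4Covariance.GaugeField.creflect`,
and the equivariance of the averages `BlockAveraging*.…_permute/_translate/_creflect`.

WHAT IS PRINTED (verbatim, p. 269).  *«Now consider a Euclidean symmetry r of the torus T, preserving the torus
T^{(k+1)}. We define generally
    (rU)(b) = U(rb),  rb = r⟨b₋, b₊⟩ = ⟨rb₋, rb₊⟩.   (2.17)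
By their definitions the expressions in (2.1) are invariant with respect to these transformations. If we split the
field V = V′V^{(k)}, and V^{(k)}, U_{k+1} transform as above, then the expressions are still invariant assuming that
V′ transforms as follows:
    (rV′)(b) = V′(rb)  if rb is positively oriented,
    (rV′)(b) = R(V^{(k)}(rb)) V′⁻¹(−(rb))  if rb is negatively oriented.   (2.18)
In these formulas the bonds b are positively oriented. Let us recall that the representation V(b) = V′(b)V^{(k)}(b)
holds for such bonds only. The above definition secures the identity r(V′V^{(k)}) = (rV′)(rV^{(k)}), hence the
invariance also. The transformation (2.18) generates an orthogonal transformation of the fluctuation field B′, hence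
all the remaining operations preserve the invariance for the same reasons as for the gauge invariance. Thus the
effective action is invariant with respect to the Euclidean transformations (2.17) of the background field.»*
(p. 265: *«We introduce new integration variables V′ = V(V^{(k)})⁻¹, or V = V′V^{(k)}, … B′ = (1/i) log V′»*;
(2.16) p. 269: `R(u)` = the adjoint action, `(R(u)B′)(b) = R(u(b₋))B′(b)`.)

WHAT THIS MODULE TYPES AND PROVES (all `theorem`s are kernel-checked group algebra / finite sums; no `Prop` fact).
* `prodCfg V′ Vk` — the split `V = V′V^{(k)}` on positively oriented bonds (p. 265).
* (2.17): the tree's `GaugeField.permute π` / `GaugeField.translate a` (every `rb` positively oriented) and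
  `GaugeField.reflect μ` (the `μ`-bonds `rb` are negatively oriented and `U(rb) := U(−rb)⁻¹`, [12] (7)) ARE (2.17);
  recorded as `eq217_permute`, `eq217_translate`, `eq217_reflect` (definitional).
* (2.18): `reflectPrime μ Vk V′` — for the reflection `r = r_μ`: `(rV′)(b) = V′(rb)` on bonds of direction `≠ μ`,
  `(rV′)(b) = R(V^{(k)}(rb)) V′⁻¹(−(rb)) = W V′(−rb)⁻¹ W⁻¹`, `W = V^{(k)}(rb) = (rV^{(k)})(b)`, on `μ`-bonds
  (`reflectPrime_apply_of_eq`); for permutations / translations (2.18) is (2.17) itself.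
* **«The above definition secures the identity r(V′V^{(k)}) = (rV′)(rV^{(k)})»** — PROVED: `reflect_prodCfg`,
  `permute_prodCfg`, `translate_prodCfg`; and `reflectPrime` is an involution over the reflected background
  (`reflectPrime_reflectPrime`), as `r_μ² = 1` requires.
* **«The transformation (2.18) generates an orthogonal transformation of the fluctuation field B′»** — for matrix
  groups `G ⊆ U(n)`: in the chart `V′ = exp(iB′)` the `μ`-bond rule reads `B′(b) ↦ −W B′(−rb) W⁻¹` (since
  `W (exp(iX))⁻¹ W⁻¹ = exp(i(−WXW⁻¹))`), the other bonds `B′(b) ↦ B′(rb)`; this map `lin218` (bondwise conjugation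
  and sign, composed with the bond reflection `PBond.reflectEquiv`) is linear (`lin218_add`, `lin218_smul`) and
  preserves the real inner product `Σ_b Re tr (B′₁(b) B′₂(b)^*)` (`lin218_orthogonal`, `lin218_normSq`; bondwise
  `reInner_conj_conj`, `reInner_neg_neg`).  The identification of `lin218` with the differential of (2.18) in the
  exponential chart is stated here in words only (the tree's `GaugeGroup` interface carries no Lie algebra, cell
  DIVERGENCE F4).
The consequences drawn in print (invariance of (2.1), of the characteristic functions, of the effective action) are
obligations on the densities of the step (`Step.SFNewTerm`, `B12SmallFieldDomain259.EuclInvariant`) and are NOT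
asserted here.  DIVERGENCE: the tree's reflections are the coordinate reflections `r_μ : x_μ ↦ −x_μ` of
`TorusHypercubicSymmetry` on ONE lattice `T^{(j)}`; the clause «preserving the torus T^{(k+1)}» (compatibility with
the block structure) is the business of the centred reflections `T4Covariance.GaugeField.creflect` and is not needed
for the algebraic identities below, which hold bond by bond.
-/

namespace Literature.MathematicalPhysics.QuantumFieldTheory.Balaban1983to89.B12EuclTransf218

open Literature.MathematicalPhysics.QuantumFieldTheory.Balaban1983to89

noncomputable section

/-! ## 1. The split `V = V′V^{(k)}` and (2.17) -/

section Split

variable {P : Params} {j : ℕ} {G : Type*} [GaugeGroup G]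

/-- The split configuration `V = V′V^{(k)}`: `V(b) = V′(b)V^{(k)}(b)` on positively oriented bonds `b`
(p. 265 «V = V′V^{(k)}»; p. 269 «the representation V(b) = V′(b)V^{(k)}(b) holds for such bonds only»).
[cite: Balaban1987RG1, (2.3) p.265] -/
def prodCfg (V' Vk : GaugeField P j G) : GaugeField P j G := fun b => V' b * Vk b

/-- `prodCfg` evaluated. [cite: Balaban1987RG1, (2.3) p.265] -/
@[simp] theorem prodCfg_apply (V' Vk : GaugeField P j G) (b : PBond P j) : prodCfg V' Vk b = V' b * Vk b := rfl

/-- With `V′ = 1` the split returns the background: `1·V^{(k)} = V^{(k)}`. [cite: Balaban1987RG1, (2.3) p.265] -/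
@[simp] theorem prodCfg_one_left (Vk : GaugeField P j G) : prodCfg 1 Vk = Vk := by
  funext b; simp [prodCfg, show (1 : GaugeField P j G) b = 1 from rfl]

omit [GaugeGroup G] in
/-- (2.17) for a coordinate permutation `r = π` (every `rb` is positively oriented): `(rU)(b) = U(rb)` — this IS the
tree's `GaugeField.permute` (`TorusHypercubicSymmetry`), recorded at the printed locus. [cite: Balaban1987RG1, (2.17) p.269] -/
theorem eq217_permute (π : Equiv.Perm (Fin P.d)) (U : GaugeField P j G) (b : PBond P j) :
    GaugeField.permute π U b = U (b.permute π) := rfl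

omit [GaugeGroup G] in
/-- (2.17) for a translation `r = τ_a` (every `rb` is positively oriented): `(rU)(b) = U(rb)` — the tree's
`GaugeField.translate` (`TorusLimitAxioms`). [cite: Balaban1987RG1, (2.17) p.269] -/
theorem eq217_translate (a : Site P j) (U : GaugeField P j G) (b : PBond P j) :
    GaugeField.translate a U b = U (b.translate a) := rfl

/-- (2.17) for the reflection `r = r_μ`: `(rU)(b) = U(rb)`, where for a `μ`-bond `b` the bond `rb` is NEGATIVELY
oriented and `U(rb) = U(−rb)⁻¹` ([12] (7)), `−rb` = the tree's positively oriented `b.reflect μ` — this IS the tree's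
`GaugeField.reflect` (`TorusHypercubicSymmetry`). [cite: Balaban1987RG1, (2.17) p.269] -/
theorem eq217_reflect (μ : Fin P.d) (U : GaugeField P j G) (b : PBond P j) :
    GaugeField.reflect μ U b = if b.dir = μ then (U (b.reflect μ))⁻¹ else U (b.reflect μ) := rfl

end Split

/-! ## 2. (2.18) and the identity `r(V′V^{(k)}) = (rV′)(rV^{(k)})` -/

section Eq218

variable {P : Params} {j : ℕ} {G : Type*} [GaugeGroup G]

/-- **(2.18) for the reflection `r = r_μ`.**  The transformed fluctuation variables `rV′` over the background
`V^{(k)}`: `(rV′)(b) = V′(rb)` if `rb` is positively oriented (bonds of direction `≠ μ`), and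
`(rV′)(b) = R(V^{(k)}(rb)) V′⁻¹(−(rb)) = W·V′(−rb)⁻¹·W⁻¹` with `W = V^{(k)}(rb) = (rV^{(k)})(b) = V^{(k)}(−rb)⁻¹` if
`rb` is negatively oriented (the `μ`-bonds; `−rb` = the tree's `b.reflect μ`; `R` = the adjoint action of (2.16)).
[cite: Balaban1987RG1, (2.18) p.269] -/
def reflectPrime (μ : Fin P.d) (Vk V' : GaugeField P j G) : GaugeField P j G := fun b =>
  if b.dir = μ then (Vk (b.reflect μ))⁻¹ * (V' (b.reflect μ))⁻¹ * Vk (b.reflect μ) else V' (b.reflect μ)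

/-- (2.18), first line: on bonds whose reflection is positively oriented, `(rV′)(b) = V′(rb)`. [cite: Balaban1987RG1, (2.18) p.269] -/
theorem reflectPrime_apply_of_ne (μ : Fin P.d) (Vk V' : GaugeField P j G) {b : PBond P j} (h : b.dir ≠ μ) :
    reflectPrime μ Vk V' b = V' (b.reflect μ) := by
  simp [reflectPrime, h]

/-- (2.18), second line, LITERALLY: on the `μ`-bonds, `(rV′)(b) = R(V^{(k)}(rb)) V′⁻¹(−(rb))` with
`V^{(k)}(rb) = (rV^{(k)})(b)` given by (2.17) (`GaugeField.reflect`) and `R(W)X = WXW⁻¹`. [cite: Balaban1987RG1, (2.18) p.269] -/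
theorem reflectPrime_apply_of_eq (μ : Fin P.d) (Vk V' : GaugeField P j G) {b : PBond P j} (h : b.dir = μ) :
    reflectPrime μ Vk V' b =
      GaugeField.reflect μ Vk b * (V' (b.reflect μ))⁻¹ * (GaugeField.reflect μ Vk b)⁻¹ := by
  simp [reflectPrime, GaugeField.reflect_apply, h]

/-- At `V′ = 1` (no fluctuation) (2.18) gives `rV′ = 1`. [cite: Balaban1987RG1, (2.18) p.269] -/
@[simp] theorem reflectPrime_one (μ : Fin P.d) (Vk : GaugeField P j G) : reflectPrime μ Vk 1 = 1 := by
  funext b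
  simp only [reflectPrime, show (1 : GaugeField P j G) (b.reflect μ) = 1 from rfl, inv_one, mul_one,
    inv_mul_cancel]
  split_ifs <;> rfl

/-- **«The above definition secures the identity r(V′V^{(k)}) = (rV′)(rV^{(k)})»** (p. 269), for the reflection
`r = r_μ`: reflecting the split configuration `V = V′V^{(k)}` by (2.17) equals the split of the (2.18)-transformed
fluctuation over the reflected background.  PROVED (bondwise group algebra: on a `μ`-bond both sides are
`V^{(k)}(−rb)⁻¹V′(−rb)⁻¹`). [cite: Balaban1987RG1, (2.18) p.269] -/
theorem reflect_prodCfg (μ : Fin P.d) (V' Vk : GaugeField P j G) :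
    GaugeField.reflect μ (prodCfg V' Vk) = prodCfg (reflectPrime μ Vk V') (GaugeField.reflect μ Vk) := by
  funext b
  simp only [GaugeField.reflect_apply, prodCfg_apply, reflectPrime]
  split_ifs with h
  · rw [mul_inv_rev, mul_assoc, mul_inv_cancel, mul_one]
  · rfl

/-- The identity `r(V′V^{(k)}) = (rV′)(rV^{(k)})` for a coordinate permutation `r = π` ((2.18) = (2.17): all `rb`
positively oriented). [cite: Balaban1987RG1, (2.18) p.269] -/
theorem permute_prodCfg (π : Equiv.Perm (Fin P.d)) (V' Vk : GaugeField P j G) :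
    GaugeField.permute π (prodCfg V' Vk) = prodCfg (GaugeField.permute π V') (GaugeField.permute π Vk) := rfl

/-- The identity `r(V′V^{(k)}) = (rV′)(rV^{(k)})` for a translation `r = τ_a` ((2.18) = (2.17)). [cite: Balaban1987RG1, (2.18) p.269] -/
theorem translate_prodCfg (a : Site P j) (V' Vk : GaugeField P j G) :
    GaugeField.translate a (prodCfg V' Vk) = prodCfg (GaugeField.translate a V') (GaugeField.translate a Vk) := rfl

/-- (2.18) is an involution over the reflected background, as `r_μ ∘ r_μ = id` demands:
`r(rV′) = V′` where the second `r` is taken over `rV^{(k)}`. [cite: Balaban1987RG1, (2.18) p.269] -/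
theorem reflectPrime_reflectPrime (μ : Fin P.d) (Vk V' : GaugeField P j G) :
    reflectPrime μ (GaugeField.reflect μ Vk) (reflectPrime μ Vk V') = V' := by
  funext b
  by_cases h : b.dir = μ
  · have h' : (b.reflect μ).dir = μ := by simpa using h
    rw [reflectPrime_apply_of_eq μ _ _ h, reflectPrime_apply_of_eq μ _ _ h', GaugeField.reflect_reflect,
      GaugeField.reflect_apply, if_pos h', PBond.reflect_reflect]
    group
  · have h' : (b.reflect μ).dir ≠ μ := by simpa using h
    rw [reflectPrime_apply_of_ne μ _ _ h, reflectPrime_apply_of_ne μ _ _ h', PBond.reflect_reflect]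

/-- Consistency of (2.18) with (2.17) on the background itself: transforming `V′ := V^{(k)}`-independent data twice —
the reflected split with `V′ = 1` is the reflected background. [cite: Balaban1987RG1, (2.18) p.269] -/
theorem reflect_prodCfg_one (μ : Fin P.d) (Vk : GaugeField P j G) :
    GaugeField.reflect μ (prodCfg 1 Vk) = prodCfg 1 (GaugeField.reflect μ Vk) := by
  rw [reflect_prodCfg, reflectPrime_one]

end Eq218

/-! ## 3. «(2.18) generates an orthogonal transformation of the fluctuation field B′» (matrix groups) -/

section Orthogonal

open Matrix

variable {n : Type*} [Fintype n]

/-- The real inner product `Re tr (X Y^*)` on `n × n` complex matrices (the bondwise inner product of 𝔤-valued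
fluctuation fields `B′`, up to the normalisation of `tr`). [cite: Balaban1987RG1, (2.16) p.269] -/
def reInner (X Y : Matrix n n ℂ) : ℝ := (Matrix.trace (X * Yᴴ)).re

/-- `Re tr ((−X)(−Y)^*) = Re tr (X Y^*)`. [cite: Balaban1987RG1, (2.18) p.269] -/
theorem reInner_neg_neg (X Y : Matrix n n ℂ) : reInner (-X) (-Y) = reInner X Y := by
  simp [reInner, Matrix.conjTranspose_neg]

variable [DecidableEq n]

/-- The adjoint action `R(W)X = W X W^*` of a unitary `W` preserves `Re tr (X Y^*)` — «they are local, orthogonal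
transformations» (p. 269, said of the `R(u)` of (2.16); the same for the `R(V^{(k)}(rb))` of (2.18)).
[cite: Balaban1987RG1, (2.16) p.269] -/
theorem reInner_conj_conj (W : Matrix.unitaryGroup n ℂ) (X Y : Matrix n n ℂ) :
    reInner ((W : Matrix n n ℂ) * X * star (W : Matrix n n ℂ)) ((W : Matrix n n ℂ) * Y * star (W : Matrix n n ℂ))
      = reInner X Y := by
  unfold reInner
  congr 1
  have hW : star (W : Matrix n n ℂ) * (W : Matrix n n ℂ) = 1 := Matrix.mem_unitaryGroup_iff'.mp W.2
  rw [Matrix.conjTranspose_mul, Matrix.conjTranspose_mul, Matrix.star_eq_conjTranspose,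
    Matrix.conjTranspose_conjTranspose]
  -- tr (W X Wᴴ · (W Yᴴ Wᴴ)) = tr (X Yᴴ)
  calc Matrix.trace ((W : Matrix n n ℂ) * X * (W : Matrix n n ℂ)ᴴ * ((W : Matrix n n ℂ) * (Yᴴ * (W : Matrix n n ℂ)ᴴ)))
      = Matrix.trace ((W : Matrix n n ℂ) * X * ((W : Matrix n n ℂ)ᴴ * (W : Matrix n n ℂ)) * Yᴴ * (W : Matrix n n ℂ)ᴴ) := by
        congr 1; simp only [Matrix.mul_assoc]
    _ = Matrix.trace ((W : Matrix n n ℂ) * (X * Yᴴ) * (W : Matrix n n ℂ)ᴴ) := by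
        rw [← Matrix.star_eq_conjTranspose, hW, Matrix.mul_one, Matrix.mul_assoc (W : Matrix n n ℂ) X]
    _ = Matrix.trace ((W : Matrix n n ℂ)ᴴ * (W : Matrix n n ℂ) * (X * Yᴴ)) := by
        rw [Matrix.trace_mul_cycle]
    _ = Matrix.trace (X * Yᴴ) := by rw [← Matrix.star_eq_conjTranspose, hW, Matrix.one_mul]

variable {P : Params} {j : ℕ}

/-- The transformation of the 𝔤-valued fluctuation field `B′` (bond functions with values in `M_n(ℂ)`) generated by
(2.18) for `r = r_μ` over a background with `μ`-bond variables `W(b) = V^{(k)}(rb) ∈ U(n)`: `(rB′)(b) = B′(rb)` on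
bonds of direction `≠ μ` and `(rB′)(b) = −R(W(b))B′(−rb) = −W(b)B′(−rb)W(b)^*` on `μ`-bonds (in the chart
`V′ = exp(iB′)`: `R(W)(exp(iX))⁻¹ = exp(i(−R(W)X))`, so this is the exact action of (2.18) on `B′ = (1/i) log V′`).
[cite: Balaban1987RG1, (2.18) p.269] -/
def lin218 (μ : Fin P.d) (W : PBond P j → Matrix.unitaryGroup n ℂ) (B : PBond P j → Matrix n n ℂ) :
    PBond P j → Matrix n n ℂ := fun b =>
  if b.dir = μ then -((W b : Matrix n n ℂ) * B (b.reflect μ) * star (W b : Matrix n n ℂ)) else B (b.reflect μ)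

/-- `lin218` is additive in `B′` (a linear transformation of the fluctuation field). [cite: Balaban1987RG1, (2.18) p.269] -/
theorem lin218_add (μ : Fin P.d) (W : PBond P j → Matrix.unitaryGroup n ℂ) (B₁ B₂ : PBond P j → Matrix n n ℂ) :
    lin218 μ W (B₁ + B₂) = lin218 μ W B₁ + lin218 μ W B₂ := by
  funext b
  simp only [lin218, Pi.add_apply]
  split_ifs with h
  · rw [Matrix.mul_add, Matrix.add_mul, neg_add]
  · rfl

/-- `lin218` commutes with complex (in particular real) scalars. [cite: Balaban1987RG1, (2.18) p.269] -/
theorem lin218_smul (μ : Fin P.d) (W : PBond P j → Matrix.unitaryGroup n ℂ) (c : ℂ) (B : PBond P j → Matrix n n ℂ) :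
    lin218 μ W (c • B) = c • lin218 μ W B := by
  funext b
  simp only [lin218, Pi.smul_apply]
  split_ifs with h
  · rw [Matrix.mul_smul, Matrix.smul_mul, smul_neg]
  · rfl

/-- **«The transformation (2.18) generates an orthogonal transformation of the fluctuation field B′»** (p. 269):
`lin218` preserves the inner product `Σ_b Re tr (B′₁(b) B′₂(b)^*)` of bond fields — bondwise by
`reInner_conj_conj` / `reInner_neg_neg`, then re-indexing the sum by the bond reflection `PBond.reflectEquiv μ`.
[cite: Balaban1987RG1, (2.18) p.269] -/
theorem lin218_orthogonal (μ : Fin P.d) (W : PBond P j → Matrix.unitaryGroup n ℂ)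
    (B₁ B₂ : PBond P j → Matrix n n ℂ) :
    ∑ b, reInner (lin218 μ W B₁ b) (lin218 μ W B₂ b) = ∑ b, reInner (B₁ b) (B₂ b) := by
  have h : ∀ b : PBond P j,
      reInner (lin218 μ W B₁ b) (lin218 μ W B₂ b) = reInner (B₁ (b.reflect μ)) (B₂ (b.reflect μ)) := by
    intro b
    unfold lin218
    split_ifs with hb
    · rw [reInner_neg_neg, reInner_conj_conj]
    · rfl
  simp_rw [h]
  exact Fintype.sum_equiv (PBond.reflectEquiv μ) _ _ (fun b => rfl)

/-- In particular `lin218` is an isometry for the norm `Σ_b Re tr (B′(b)B′(b)^*) = Σ_b |B′(b)|²`.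
[cite: Balaban1987RG1, (2.18) p.269] -/
theorem lin218_normSq (μ : Fin P.d) (W : PBond P j → Matrix.unitaryGroup n ℂ) (B : PBond P j → Matrix n n ℂ) :
    ∑ b, reInner (lin218 μ W B b) (lin218 μ W B b) = ∑ b, reInner (B b) (B b) :=
  lin218_orthogonal μ W B B

end Orthogonal

end

end Literature.MathematicalPhysics.QuantumFieldTheory.Balaban1983to89.B12EuclTransf218
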